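import Summits.QuantumFields.BalabanUV.Beta.FP.TransportLimit
import Literature.MathematicalPhysics.QuantumFieldTheory.Balaban1983to89.Beta.HessianTelescopingKKT
import Literature.MathematicalPhysics.QuantumFieldTheory.Balaban1983to89.Beta.PolarizationSign

/-!
# `BalabanUV.Beta.FP.TransportInfinity` — road «FP» for binder row D1, leaf N5b (one-step part): the PERFECT ONE-STEP TRANSPORT — the entrywise
# limit of an4's normalised minimiser columns `HessianTelescopingKKT.wStep Lc j` — REPRODUCES CONSTANTS with the SAME coset mass `Lc⁻⁵` and
# REPRODUCES LINEAR DATA, given only entrywise convergence under a `j`-uniform exponential majorant (the (CONV-C-Cauchy) K-binder's field–multiplier block)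

HONEST FRAMING (cell contract, verbatim): «discharging `BetaPertH` makes Bałaban's UV stability UNCONDITIONAL — a real constructive-QFT result;
it is NOT the continuum limit and NOT the Clay problem.»  THIS MODULE DISCHARGES NOTHING: it combines an4's finite-level Strang–Fix identities
`constReproSum_wStep` / `linReproSum_wStep` (every `j`) with `FP/TransportLimit` (Tannery).  Convergence and the majorant are HYPOTHESES (row G-an2-4 side).
Skeleton `HOME/beta/skeletons/D1-b2b-balaban-beta-d1-p3.md` leaf N5; claim table `HOME/b2b-balaban-beta-d1-p3/LEAVES-FP.md` row N5b.  NOT BetaPertH/continuum/Clay.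
ABSOLUTE RULE (cell, verbatim): «No internally-minted statement may enter as a cited fact. Every hypothesis is either kernel-proved in this package or a
verbatim quotation of a PUBLISHED theorem with page reference.»  Nothing is cited; no `def`.

CONTENT: `summable_const_mul_exp_neg_l1`, `summable_abs_coord_mul_exp_neg_l1` (the majorants `A·e^{−δ|u|₁}` and `|u_κ|·A·e^{−δ|u|₁}` are summable on `ℤ^D`);
`exists_linReproSum_of_tendsto` (the `LinReproSum` constants converge by themselves — Tannery at the coset of `0`); **`constReproSum_of_tendsto_wStep`**,
**`exists_linReproSum_of_tendsto_wStep`**: for ANY entrywise limit `wInf` of `j ↦ wStep Lc j` under a `j`-uniform exponential majorant,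
`ConstReproSum Lc (wInf κ l) (δ_{κl}·Lc⁻⁵)` and `∃ C, LinReproSum Lc (wInf κ l) C` — the Strang–Fix order-2 data of the perfect one-step minimiser, the input of
`StrangFixMoment.strangFix_second_moment` / `DecimatedMomentSummable.decimatedSum_second_moment_of_spec` in leaf N5 (transport invariance of the marginal coefficient).
-/

namespace Summit.QuantumFields.BalabanUV.Beta.FP.TransportInfinity

open Filter Topology
open Literature.MathematicalPhysics.QuantumFieldTheory.Balaban1983to89
open Literature.MathematicalPhysics.QuantumFieldTheory.Balaban1983to89.Beta
open B12Sec2to5 (l1 l1_nonneg)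
open DecimatedMoment (cosetInd)
open DecimatedMomentSummable (ConstReproSum LinReproSum)
open HessianTelescopingKKT (wStep constReproSum_wStep linReproSum_wStep)
open Summit.QuantumFields.BalabanUV.Beta.FP.TransportLimit (hasSum_of_dominated_tendsto constReproSum_of_tendsto linReproSum_of_tendsto
  abs_cosetInd_le_one)

/-! ## §1 The exponential majorants are summable -/

/-- [our object] `u ↦ A·e^{−δ|u|₁}` is summable on `ℤ^D` (`δ > 0`). -/
theorem summable_const_mul_exp_neg_l1 {D : ℕ} (A : ℝ) {δ : ℝ} (hδ : 0 < δ) :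
    Summable fun u : Fin D → ℤ => A * Real.exp (-δ * l1 u) :=
  (B12Sec2to5.summable_exp_neg_l1 hδ D).mul_left A

/-- [our object] `u ↦ |u_κ|·A·e^{−δ|u|₁}` is summable on `ℤ^D` (`δ > 0`, `A ≥ 0`): `|u_κ| ≤ |u|₁ ≤ 1 + |u|₁` and `(1+s)e^{−δs} ≤ c·e^{−(δ/2)s}`. -/
theorem summable_abs_coord_mul_exp_neg_l1 {D : ℕ} {A δ : ℝ} (hA : 0 ≤ A) (hδ : 0 < δ) (κ : Fin D) :
    Summable fun u : Fin D → ℤ => |((u κ : ℤ) : ℝ)| * (A * Real.exp (-δ * l1 u)) := by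
  set c : ℝ := ((1 : ℕ).factorial : ℝ) * Real.exp (δ / 2) / (δ / 2) ^ 1 with hc
  have hc0 : 0 ≤ c := by rw [hc]; positivity
  refine Summable.of_nonneg_of_le (fun u => by positivity) (fun u => ?_)
    ((B12Sec2to5.summable_exp_neg_l1 (half_pos hδ) D).mul_left (A * c))
  have h1 : |((u κ : ℤ) : ℝ)| ≤ l1 u := by
    unfold B12Sec2to5.l1
    exact Finset.single_le_sum (f := fun i => |((u i : ℤ) : ℝ)|) (fun i _ => abs_nonneg _) (Finset.mem_univ κ)
  have h2 : l1 u ≤ (1 + l1 u) ^ 1 := by rw [pow_one]; linarith [l1_nonneg u]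
  have h3 := PolarizationSign.one_add_pow_mul_exp_neg_le hδ 1 (l1_nonneg u)
  calc |((u κ : ℤ) : ℝ)| * (A * Real.exp (-δ * l1 u)) ≤ (1 + l1 u) ^ 1 * (A * Real.exp (-δ * l1 u)) :=
        mul_le_mul_of_nonneg_right (h1.trans h2) (by positivity)
    _ = A * ((1 + l1 u) ^ 1 * Real.exp (-δ * l1 u)) := by ring
    _ ≤ A * (c * Real.exp (-(δ / 2) * l1 u)) := mul_le_mul_of_nonneg_left h3 hA
    _ = A * c * Real.exp (-(δ / 2) * l1 u) := by ring

/-! ## §2 The `LinReproSum` constants converge by themselves -/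

/-- [our object] **REPRODUCTION OF LINEAR DATA PASSES TO DOMINATED LIMITS, constants included**: if every `w j` reproduces linear data with SOME constants
`C j`, and `w j → w∞` entrywise under a summable first-moment majorant, then `w∞` reproduces linear data (with the limit constants). -/
theorem exists_linReproSum_of_tendsto {d : ℕ} {N : ℕ} {w : ℕ → (Fin d → ℤ) → ℝ} {winf : (Fin d → ℤ) → ℝ}
    {g : (Fin d → ℤ) → ℝ} (hg1 : ∀ κ, Summable fun u => |((u κ : ℤ) : ℝ)| * g u) (hbound : ∀ j u, |w j u| ≤ g u)
    (hlim : ∀ u, Tendsto (fun j => w j u) atTop (𝓝 (winf u))) (hrep : ∀ j, ∃ C : Fin d → ℝ, LinReproSum N (w j) C) :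
    ∃ C : Fin d → ℝ, LinReproSum N winf C := by
  choose C hC using hrep
  refine ⟨fun κ => ∑' u, ((cosetInd N (0 - u) * u κ : ℤ) : ℝ) * winf u, linReproSum_of_tendsto hg1 hbound hlim hC fun κ => ?_⟩
  -- the constants are the coset-`0` sums, which converge by Tannery
  have hsum : ∀ j, C j κ = ∑' u, ((cosetInd N (0 - u) * u κ : ℤ) : ℝ) * w j u := fun j => by
    rw [← (hC j 0 κ).tsum_eq]; simp only [zsmul_eq_mul]
  have hb : ∀ j u, |((cosetInd N (0 - u) * u κ : ℤ) : ℝ) * w j u| ≤ |((u κ : ℤ) : ℝ)| * g u := fun j u => by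
    rw [abs_mul, Int.cast_mul, abs_mul]
    calc |((cosetInd N (0 - u) : ℤ) : ℝ)| * |((u κ : ℤ) : ℝ)| * |w j u| ≤ 1 * |((u κ : ℤ) : ℝ)| * g u := by
          apply mul_le_mul (mul_le_mul_of_nonneg_right (abs_cosetInd_le_one N (0 - u)) (abs_nonneg _)) (hbound j u) (abs_nonneg _)
          positivity
      _ = |((u κ : ℤ) : ℝ)| * g u := by ring
  have ht : Tendsto (fun j => ∑' u, ((cosetInd N (0 - u) * u κ : ℤ) : ℝ) * w j u) atTop
      (𝓝 (∑' u, ((cosetInd N (0 - u) * u κ : ℤ) : ℝ) * winf u)) :=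
    tendsto_tsum_of_dominated_convergence (hg1 κ) (fun u => (hlim u).const_mul _)
      (Eventually.of_forall fun j u => by rw [Real.norm_eq_abs]; exact hb j u)
  simpa only [hsum] using ht

/-! ## §3 The perfect one-step transport reproduces affine data -/

variable {Lc : ℕ} [NeZero Lc]

/-- [our object] **THE PERFECT ONE-STEP TRANSPORT REPRODUCES CONSTANTS, COSET MASS `Lc⁻⁵`**: for ANY entrywise limit `wInf κ l` of an4's normalised minimiser
columns `j ↦ wStep Lc j κ l` under a `j`-uniform exponential majorant, `ConstReproSum Lc (wInf κ l) (δ_{κl}·(Lc^5)⁻¹)` — the mass an4 proved at EVERY finite `j`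
(`constReproSum_wStep`) survives the limit (`FP/TransportLimit.constReproSum_of_tendsto`). -/
theorem constReproSum_of_tendsto_wStep {wInf : Fin 4 → Fin 4 → (Fin 4 → ℤ) → ℝ} {A δ : ℝ} (hδ : 0 < δ)
    (hbound : ∀ j κ l u, |wStep Lc j κ l u| ≤ A * Real.exp (-δ * l1 u))
    (hlim : ∀ κ l u, Tendsto (fun j => wStep Lc j κ l u) atTop (𝓝 (wInf κ l u))) (κ l : Fin 4) :
    ConstReproSum Lc (wInf κ l) (if κ = l then (((Lc : ℝ) ^ (4 + 1))⁻¹) else 0) :=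
  constReproSum_of_tendsto (w := fun j => wStep Lc j κ l) (σ := fun _ => if κ = l then (((Lc : ℝ) ^ (4 + 1))⁻¹) else 0)
    (summable_const_mul_exp_neg_l1 A hδ) (fun j u => hbound j κ l u) (hlim κ l) (fun j => constReproSum_wStep j κ l)
    tendsto_const_nhds

/-- [our object] **THE PERFECT ONE-STEP TRANSPORT REPRODUCES LINEAR DATA**: under the same hypotheses (and `A ≥ 0`), `∃ C, LinReproSum Lc (wInf κ l) C`
(`linReproSum_wStep` at every `j` + `exists_linReproSum_of_tendsto`). -/
theorem exists_linReproSum_of_tendsto_wStep {wInf : Fin 4 → Fin 4 → (Fin 4 → ℤ) → ℝ} {A δ : ℝ} (hA : 0 ≤ A) (hδ : 0 < δ)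
    (hbound : ∀ j κ l u, |wStep Lc j κ l u| ≤ A * Real.exp (-δ * l1 u))
    (hlim : ∀ κ l u, Tendsto (fun j => wStep Lc j κ l u) atTop (𝓝 (wInf κ l u))) (κ l : Fin 4) :
    ∃ C : Fin 4 → ℝ, LinReproSum Lc (wInf κ l) C :=
  exists_linReproSum_of_tendsto (w := fun j => wStep Lc j κ l) (summable_abs_coord_mul_exp_neg_l1 hA hδ)
    (fun j u => hbound j κ l u) (hlim κ l) (fun j => linReproSum_wStep j κ l)

end Summit.QuantumFields.BalabanUV.Beta.FP.TransportInfinity
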